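import Mathlib
import Summits.Ventures.PercRepro.PuncturedLYMFibration
import Summits.Ventures.PercRepro.PuncturedLYMSplitOneCoHyp
import Summits.Ventures.PercRepro.PuncturedLYMFibrationOneLayers

/-!
# PercRepro — THE EXACT CRITERION FOR ONE DECORATED MEMBER: FEASIBLE IFF THE ADJACENT ROWS CAN PAY
(p10, gen 37)

One member `C ⊆ S` of size `m` (`2 ≤ m ≤ ℓ`, `ℓ + 1 ≤ #(S ∖ C)`): rows = the `ℓ`-subsets of `S` not containing `C`
(`rowsOne S ℓ C`), member columns (`⊇ C`) at demand `1`, free columns at demand `θ ≥ 0`, uniform row mass `ρ` with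
the totals.  THEOREM (`hasFlow_rowsOne_decorated`): **if `m·ρ ≥ 1` the instance has a flow** — the member columns can
be paid by their `m` adjacent rows.  (The converse is the column-Hall condition of the member columns.)  PROOF: the
fibration over `C` (`hasFlow_fibration`) with the layer weights `hl a = Hs (a+1)/((m−a)·R a)` on the horizontal edges
and the free flow (`hasFlow_free`) on every fibre `A ⊊ C` (a full Boolean level of `S ∖ C` with base
`D a = θ − a·hl (a−1)`); the fibre over `C` has no rows and its columns are paid exactly by `m·hl (m−1) = 1`; the
two families of constraints `hl a ≥ 0`, `D a ≥ 0` are `layer_ineq` (PuncturedLYMFibrationOneLayers).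
-/

namespace PercRepro.PuncturedLYM.Split

open Finset OneArith

variable {α : Type} [DecidableEq α]

/-- The layer weights of the fibration over one member. -/
def hl (m n' ℓ : ℕ) (ρ θ : ℚ) (a : ℕ) : ℚ :=
  if a < m then Hs m n' ℓ ρ θ (a + 1) / (((m - a : ℕ) : ℚ) * R m n' ℓ a) else 0

section Arith

variable {m n' ℓ : ℕ} {ρ θ : ℚ}

/-- `R a > 0` for `a ≤ m`, `ℓ ≤ n'`. -/
theorem R_pos (hmℓ : m ≤ ℓ) (hn : ℓ ≤ n') (a : ℕ) (ha : a ≤ m) : 0 < R m n' ℓ a := by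
  unfold R
  have h1 : 0 < m.choose a := Nat.choose_pos ha
  have h2 : 0 < n'.choose (ℓ - a) := Nat.choose_pos (by omega)
  positivity

/-- `(m − a)·hl a·R a = Hs (a+1)` (`a < m`). -/
theorem hl_mul (hmℓ : m ≤ ℓ) (hn : ℓ ≤ n') (a : ℕ) (ha : a < m) :
    ((m - a : ℕ) : ℚ) * hl m n' ℓ ρ θ a * R m n' ℓ a = Hs m n' ℓ ρ θ (a + 1) := by
  unfold hl
  rw [if_pos ha]
  have hR := R_pos hmℓ hn a ha.le
  have hma : (0 : ℚ) < ((m - a : ℕ) : ℚ) := by exact_mod_cast (by omega : 0 < m - a)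
  field_simp

/-- `a·hl (a−1)·U a = Hs a` (`1 ≤ a < m`): `C(m,a)·a = C(m,a−1)·(m−a+1)`. -/
theorem hl_pred_mul (hmℓ : m ≤ ℓ) (hn : ℓ ≤ n') (a : ℕ) (ha1 : 1 ≤ a) (ha : a < m) :
    (a : ℚ) * hl m n' ℓ ρ θ (a - 1) * U m n' ℓ a = Hs m n' ℓ ρ θ a := by
  have h := hl_mul (ρ := ρ) (θ := θ) hmℓ hn (a - 1) (by omega)
  rw [show a - 1 + 1 = a by omega] at h
  rw [← h]
  -- `U a / R (a−1) = (m − a + 1)/a`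
  unfold U R
  have e1 : ℓ - (a - 1) = ℓ + 1 - a := by omega
  rw [e1]
  have hch : (m.choose a : ℚ) * a = (m.choose (a - 1) : ℚ) * ((m - (a - 1) : ℕ) : ℚ) := by
    have := choose_succ_right_eq_q m (a - 1)
    rw [show a - 1 + 1 = a by omega] at this
    have hc : ((a - 1 : ℕ) : ℚ) + 1 = a := by rw [Nat.cast_sub ha1]; push_cast; ring
    rw [hc] at this
    exact this
  have e2 : ((m - (a - 1) : ℕ) : ℚ) = ((m - a : ℕ) : ℚ) + 1 := by
    rw [show m - (a - 1) = m - a + 1 by omega]; push_cast; ring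
  rw [e2] at hch
  have e3 : ((m - (a - 1) : ℕ) : ℚ) = ((m - a : ℕ) : ℚ) + 1 := by
    rw [show m - (a - 1) = m - a + 1 by omega]; push_cast; ring
  rw [e3]
  linear_combination (hl m n' ℓ ρ θ (a - 1) * (n'.choose (ℓ + 1 - a) : ℚ)) * hch

/-- The base of fibre `a`: `D a = θ − a·hl (a−1)`. -/
def D (m n' ℓ : ℕ) (ρ θ : ℚ) (a : ℕ) : ℚ := θ - a * hl m n' ℓ ρ θ (a - 1)

/-- The row mass of fibre `a`: `v a = ρ − (m − a)·hl a`. -/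
def v (m n' ℓ : ℕ) (ρ θ : ℚ) (a : ℕ) : ℚ := ρ - ((m - a : ℕ) : ℚ) * hl m n' ℓ ρ θ a

/-- The fibre identity `v a · C(n',ℓ−a) = D a · C(n',ℓ+1−a)` (`a < m`). -/
theorem v_mul_eq (hmℓ : m ≤ ℓ) (hn : ℓ ≤ n') (a : ℕ) (ha : a < m) :
    v m n' ℓ ρ θ a * (n'.choose (ℓ - a) : ℚ) = D m n' ℓ ρ θ a * (n'.choose (ℓ + 1 - a) : ℚ) := by
  have hmc : (0 : ℚ) < (m.choose a : ℚ) := by exact_mod_cast Nat.choose_pos ha.le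
  have h1 := hl_mul (ρ := ρ) (θ := θ) hmℓ hn a ha
  have hstep : Hs m n' ℓ ρ θ (a + 1) = Hs m n' ℓ ρ θ a + e m n' ℓ ρ θ a := by
    unfold Hs; rw [sum_range_succ]
  have h2 : (a : ℚ) * hl m n' ℓ ρ θ (a - 1) * U m n' ℓ a = Hs m n' ℓ ρ θ a := by
    rcases Nat.eq_zero_or_pos a with ha0 | ha0
    · subst ha0; simp [Hs]
    · exact hl_pred_mul hmℓ hn a ha0 ha
  -- multiply the claim by `C(m,a)`
  have : v m n' ℓ ρ θ a * R m n' ℓ a = D m n' ℓ ρ θ a * U m n' ℓ a := by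
    unfold v D
    unfold e at hstep
    linear_combination -h1 + h2 - hstep
  unfold R U at this
  have := this
  apply mul_left_cancel₀ hmc.ne'
  linear_combination this

end Arith


section Glue

variable {S C A : Finset α}

/-- For `Z ⊆ S ∖ C` and `A ⊆ C`: `(A ∪ Z) ∩ C = A`. -/
theorem union_inter_eq_of_subset_sdiff (hA : A ⊆ C) {Z : Finset α} (hZ : Z ⊆ S \ C) : (A ∪ Z) ∩ C = A := by
  ext x
  simp only [mem_inter, mem_union]
  constructor
  · rintro ⟨hx | hx, hxC⟩
    · exact hx
    · exact absurd hxC (mem_sdiff.1 (hZ hx)).2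
  · intro hx; exact ⟨Or.inl hx, hA hx⟩

/-- For `A ⊊ C` and `W ⊆ S ∖ C`: `C ⊄ A ∪ W`. -/
theorem not_subset_union_of_ssubset (hA : A ⊆ C) (hne : A ≠ C) {W : Finset α} (hW : W ⊆ S \ C) :
    ¬ C ⊆ A ∪ W := by
  intro h
  apply hne
  apply Subset.antisymm hA
  intro c hc
  rcases mem_union.1 (h hc) with h1 | h1
  · exact h1
  · exact absurd hc (mem_sdiff.1 (hW h1)).2

/-- The fibre rows over `A ⊊ C` are all the `(ℓ − #A)`-subsets of `S ∖ C`. -/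
theorem fibRows_rowsOne (hC : C ⊆ S) {ℓ : ℕ} (hA : A ⊆ C) (hne : A ≠ C) (hAℓ : A.card ≤ ℓ) :
    fibRows (rowsOne S ℓ C) C A = (S \ C).powersetCard (ℓ - A.card) := by
  ext Z
  rw [mem_fibRows hA, mem_powersetCard, mem_rowsOne]
  constructor
  · rintro ⟨hZC, hZS, hcard, _⟩
    have hZ : Z ⊆ S \ C := by
      intro z hz
      exact mem_sdiff.2 ⟨hZS (mem_union_right A hz), fun hzC => disjoint_left.1 hZC hz hzC⟩
    refine ⟨hZ, ?_⟩
    rw [card_union_of_disjoint (disjoint_of_subset_left hA hZC.symm)] at hcard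
    omega
  · rintro ⟨hZ, hcard⟩
    have hZC : Disjoint Z C := disjoint_of_subset_left hZ sdiff_disjoint
    refine ⟨hZC, union_subset (hA.trans hC) (hZ.trans sdiff_subset), ?_, not_subset_union_of_ssubset hA hne hZ⟩
    rw [card_union_of_disjoint (disjoint_of_subset_left hA hZC.symm)]
    omega

/-- The fibre rows over `C` itself: none. -/
theorem fibRows_rowsOne_self {ℓ : ℕ} : fibRows (rowsOne S ℓ C) C C = ∅ := by
  ext Z
  simp only [mem_fibRows subset_rfl, mem_rowsOne, notMem_empty, iff_false, not_and]
  intro _ _ _ h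
  exact h subset_union_left

/-- For `c ∈ A ⊆ C ⊆ S` and `W ⊆ S ∖ C` with `#W = ℓ + 1 − #A`: `(A ∖ c) ∪ W` is a row meeting `C` in `A ∖ c`. -/
theorem erase_union_mem_rowsOne (hC : C ⊆ S) (ℓ : ℕ) (hA : A ⊆ C) (hAℓ : A.card ≤ ℓ + 1)
    {c : α} (hc : c ∈ A) {W : Finset α} (hW : W ⊆ S \ C) (hWc : W.card = ℓ + 1 - A.card) :
    (A.erase c) ∪ W ∈ rowsOne S ℓ C ∧ ((A.erase c) ∪ W) ∩ C = A.erase c := by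
  have hAc : A.erase c ⊆ C := (erase_subset c A).trans hA
  have hdis : Disjoint (A.erase c) W := disjoint_of_subset_left hAc (disjoint_of_subset_right hW disjoint_sdiff)
  refine ⟨?_, union_inter_eq_of_subset_sdiff hAc hW⟩
  rw [mem_rowsOne]
  refine ⟨union_subset (hAc.trans hC) (hW.trans sdiff_subset), ?_, ?_⟩
  · rw [card_union_of_disjoint hdis, card_erase_of_mem hc, hWc]
    have : 1 ≤ A.card := card_pos.2 ⟨c, hc⟩
    omega
  · intro h
    have hcC : c ∈ C := hA hc
    rcases mem_union.1 (h hcC) with h1 | h1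
    · exact (mem_erase.1 h1).1 rfl
    · exact (mem_sdiff.1 (hW h1)).2 hcC

/-- **THE EXACT CRITERION (sufficiency).** One member `C ⊆ S` of size `m`, `2 ≤ m ≤ ℓ`, `ℓ + 1 ≤ #(S ∖ C)`; member
columns at demand `1`, free columns at demand `θ ≥ 0`, uniform rows `ρ` with the totals
`ρ·(C(n,ℓ) − C(n',ℓ−m)) = C(n',ℓ+1−m) + θ·(C(n,ℓ+1) − C(n',ℓ+1−m))`.  If `m·ρ ≥ 1`, the instance has a flow. -/
theorem hasFlow_rowsOne_decorated (hC : C ⊆ S) {ℓ : ℕ} (hm : 2 ≤ C.card) (hmℓ : C.card ≤ ℓ)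
    (hn : ℓ + 1 ≤ (S \ C).card) {ρ θ : ℚ} (hθ : 0 ≤ θ) (hC1 : 1 ≤ (C.card : ℚ) * ρ)
    (htot : ρ * ((S.card.choose ℓ : ℚ) - ((S \ C).card.choose (ℓ - C.card) : ℚ))
      = ((S \ C).card.choose (ℓ + 1 - C.card) : ℚ)
        + θ * ((S.card.choose (ℓ + 1) : ℚ) - ((S \ C).card.choose (ℓ + 1 - C.card) : ℚ))) :
    HasFlow S ℓ (rowsOne S ℓ C) (fun _ => ρ) (fun Y => if C ⊆ Y then 1 else θ) := by
  set m := C.card with hm_def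
  set n' := (S \ C).card with hn'_def
  have hcard : S.card = m + n' := by
    rw [hm_def, hn'_def, add_comm]
    exact (card_sdiff_add_card_eq_card hC).symm
  have hnℓ : ℓ ≤ n' := by omega
  -- the totals in layer form
  have htot' : ρ * ∑ a ∈ range m, R m n' ℓ a = N m n' ℓ + θ * ∑ a ∈ range m, U m n' ℓ a := by
    rw [sum_R hmℓ, sum_U hmℓ]
    unfold N
    rw [← hcard]
    exact htot
  obtain ⟨hH, hD⟩ := layer_ineq hm hmℓ hn hθ hC1 htot'
  have hNpos : 0 < N m n' ℓ := by
    unfold N; exact_mod_cast Nat.choose_pos (by omega)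
  -- the layer weights are nonnegative
  have hhl : ∀ a, 0 ≤ hl m n' ℓ ρ θ a := by
    intro a
    unfold hl
    split_ifs with ha
    · apply div_nonneg (hH (a + 1) (by omega))
      exact mul_nonneg (by positivity) (R_pos hmℓ hnℓ a ha.le).le
    · exact le_rfl
  -- `D a ≥ 0` for `a < m`
  have hDnn : ∀ a, a < m → 0 ≤ D m n' ℓ ρ θ a := by
    intro a ha
    unfold D
    rcases Nat.eq_zero_or_pos a with ha0 | ha0
    · subst ha0; simpa using hθ
    · have h1 := hl_pred_mul (ρ := ρ) (θ := θ) hmℓ hnℓ a ha0 ha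
      have h2 := hD a ha0 ha
      have hU : 0 < U m n' ℓ a := by
        unfold U
        have : 0 < n'.choose (ℓ + 1 - a) := Nat.choose_pos (by omega)
        have : 0 < m.choose a := Nat.choose_pos ha.le
        positivity
      have : (a : ℚ) * hl m n' ℓ ρ θ (a - 1) ≤ θ := by
        have := h1 ▸ h2
        exact le_of_mul_le_mul_right this hU
      linarith
  -- `hl (m−1) = 1/m`
  have hlast : (m : ℚ) * hl m n' ℓ ρ θ (m - 1) = 1 := by
    have h := hl_mul (ρ := ρ) (θ := θ) hmℓ hnℓ (m - 1) (by omega)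
    rw [show m - 1 + 1 = m by omega, Hs_top htot', R_pred_eq (by omega) hmℓ,
      show m - (m - 1) = 1 by omega] at h
    push_cast at h
    have : (1 : ℚ) * hl m n' ℓ ρ θ (m - 1) * (m * N m n' ℓ) = (m * hl m n' ℓ ρ θ (m - 1)) * N m n' ℓ := by ring
    rw [this] at h
    have := mul_right_cancel₀ hNpos.ne' (h.trans (one_mul _).symm)
    exact this
  apply hasFlow_fibration hC (rowsOne_subset S ℓ C) (fun X _ => hl m n' ℓ ρ θ (X ∩ C).card)
    (fun X _ => hhl _)
  · -- the fibres
    intro A hA hAℓ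
    by_cases hne : A = C
    · -- the fibre over `C`: no rows; every column is paid horizontally
      subst hne
      rw [fibRows_rowsOne_self]
      refine ⟨fun _ _ => 0, fun _ _ => le_rfl, fun X hX => absurd hX (notMem_empty X), ?_⟩
      intro W hW
      obtain ⟨hWS, hWc⟩ := mem_cols.1 hW
      simp only [subs, filter_empty, sum_empty]
      rw [if_pos subset_union_left]
      have hterm : ∀ c ∈ A, (if (A.erase c) ∪ W ∈ rowsOne S ℓ A then hl m n' ℓ ρ θ (((A.erase c) ∪ W) ∩ A).card else 0)
          = hl m n' ℓ ρ θ (m - 1) := by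
        intro c hc
        obtain ⟨hrow, hint⟩ := erase_union_mem_rowsOne hC ℓ subset_rfl (by omega) hc hWS (by rw [hWc]; omega)
        rw [if_pos hrow, hint, card_erase_of_mem hc]
      rw [sum_congr rfl hterm, sum_const, nsmul_eq_mul, ← hm_def, hlast]
      ring
    · -- a fibre over `A ⊊ C`: the free flow with base `D a`
      set a := A.card with ha_def
      have ha : a < m := by
        rw [ha_def, hm_def]
        exact card_lt_card ⟨hA, fun h => hne (Subset.antisymm hA h)⟩
      rw [fibRows_rowsOne hC hA hne hAℓ, ← ha_def]
      have hjn : ℓ - a < n' := by omega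
      have hv0 : 0 ≤ v m n' ℓ ρ θ a := by
        have h := v_mul_eq (ρ := ρ) (θ := θ) hmℓ hnℓ a ha
        have hpos : (0 : ℚ) < (n'.choose (ℓ - a) : ℚ) := by exact_mod_cast Nat.choose_pos (by omega)
        have : 0 ≤ D m n' ℓ ρ θ a * (n'.choose (ℓ + 1 - a) : ℚ) := mul_nonneg (hDnn a ha) (by positivity)
        rw [← h] at this
        exact nonneg_of_mul_nonneg_left this hpos
      refine hasFlow_congr ?_ ?_ (hasFlow_free (S \ C) (ℓ - a) hjn (v m n' ℓ ρ θ a) hv0)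
      · -- rows: `ρ − (m − a)·hl a`
        intro Z hZ
        have hZS : Z ⊆ S \ C := (mem_powersetCard.1 hZ).1
        rw [union_inter_eq_of_subset_sdiff hA hZS, ← ha_def, sum_const, card_sdiff_of_subset hA, ← hm_def, ← ha_def,
          nsmul_eq_mul]
        rfl
      · -- columns: `θ − a·hl (a−1)`
        intro W hW
        obtain ⟨hWS, hWc⟩ := mem_cols.1 hW
        rw [if_neg (not_subset_union_of_ssubset hA hne hWS)]
        have hterm : ∀ c ∈ A, (if (A.erase c) ∪ W ∈ rowsOne S ℓ C then hl m n' ℓ ρ θ (((A.erase c) ∪ W) ∩ C).card else 0)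
            = hl m n' ℓ ρ θ (a - 1) := by
          intro c hc
          obtain ⟨hrow, hint⟩ := erase_union_mem_rowsOne hC ℓ hA (by omega) hc hWS (by rw [hWc]; omega)
          rw [if_pos hrow, hint, card_erase_of_mem hc]
        rw [sum_congr rfl hterm, sum_const, nsmul_eq_mul, ← ha_def]
        -- `(ℓ−a+1)·v/(n' − (ℓ−a)) = D a` from `v·C(n',ℓ−a) = D·C(n',ℓ+1−a)`
        have h := v_mul_eq (ρ := ρ) (θ := θ) hmℓ hnℓ a ha
        have hid : (n'.choose (ℓ + 1 - a) : ℚ) * ((ℓ - a : ℕ) + 1) = (n'.choose (ℓ - a) : ℚ) * ((n' - (ℓ - a) : ℕ) : ℚ) := by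
          have := choose_succ_right_eq_q n' (ℓ - a)
          rwa [show ℓ - a + 1 = ℓ + 1 - a by omega] at this
        have hpos1 : (0 : ℚ) < (n'.choose (ℓ - a) : ℚ) := by exact_mod_cast Nat.choose_pos (by omega)
        have hpos2 : (0 : ℚ) < ((n' - (ℓ - a) : ℕ) : ℚ) := by exact_mod_cast (by omega : 0 < n' - (ℓ - a))
        have hcast : ((n' - (ℓ - a) : ℕ) : ℚ) = (n' : ℚ) - ((ℓ - a : ℕ) : ℚ) := by
          rw [Nat.cast_sub (by omega)]
        show (((ℓ - a : ℕ) : ℚ) + 1) * v m n' ℓ ρ θ a / (((S \ C).card : ℚ) - ((ℓ - a : ℕ) : ℚ)) = θ - a * hl m n' ℓ ρ θ (a - 1)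
        rw [← hn'_def, ← hcast, div_eq_iff hpos2.ne']
        have hD : D m n' ℓ ρ θ a = θ - a * hl m n' ℓ ρ θ (a - 1) := rfl
        rw [← hD]
        -- from `h` and `hid`: `v·C(ℓ−a)·(ℓ−a+1) = D·C(ℓ+1−a)·(ℓ−a+1) = D·C(ℓ−a)·(n'−(ℓ−a))`
        have : (n'.choose (ℓ - a) : ℚ) * ((((ℓ - a : ℕ) : ℚ) + 1) * v m n' ℓ ρ θ a)
            = (n'.choose (ℓ - a) : ℚ) * (D m n' ℓ ρ θ a * ((n' - (ℓ - a) : ℕ) : ℚ)) := by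
          linear_combination (((ℓ - a : ℕ) : ℚ) + 1) * h + D m n' ℓ ρ θ a * hid
        exact mul_left_cancel₀ hpos1.ne' this
  · -- no column inside `C` (`#C = m ≤ ℓ < ℓ + 1`)
    intro Y hY hYC
    obtain ⟨_, hYc⟩ := mem_cols.1 hY
    have := card_le_card hYC
    omega

end Glue

end PercRepro.PuncturedLYM.Split
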